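import Summits.CriticalPhenomena.SAWScalingLimit.Theorems.SAWDevelopingMapHexConjectureKPDichotomy
import Summits.CriticalPhenomena.SAWScalingLimit.Theorems.SAWDevelopingMapHexConjectureKPCor31
import Summits.CriticalPhenomena.SAWScalingLimit.Theorems.SAWDevelopingMapHexConjectureKPDecay
import Summits.CriticalPhenomena.SAWScalingLimit.Theorems.SAWDevelopingMapHexConjectureKPWindowTail
import HarnessLib

/-!
# Crux `HexConjecture` (stmt-CriticalPhenomena-0808), line `root-locality-replaces-loewner`:
Krachun–Panagiotis's theorem — polynomial decay of the critical triangle / bridge tails (registered stub `stub_kp_theorem2`)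

Landing target:
`Summits/CriticalPhenomena/SAWScalingLimit/Theorems/SAWDevelopingMapHexConjectureKPTheorem2.lean`
(`--supports stmt-CriticalPhenomena-0808`; lead prover-line-stmt-CriticalPhenomena-0808-c9-0).

The UNCONDITIONAL by-product of the line's formalisation of [KP, §3]: the Glazman–Manolescu triangle tail
`triDl T` (half of KP's `D_{2T+1}`; it dominates the critical bridge partition functions,
`HV.stripB_le_triDl : B_{T'} ≤ 2cos(π/8)·triDl T` for `2T+1 ≤ T'`) decays POLYNOMIALLY:
`triDl T ≤ C · T^(-ε)` for some `ε > 0` — Krachun–Panagiotis's Theorems 2–3 ("`B_T ≤ D_T ≤ 100·T^(-10⁻¹⁰)`",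
the first quantitative sub-ballisticity estimate for the hexagonal-lattice SAW), here with an unspecified
exponent.  Pure composition of the landed pieces: the dichotomy of constructions (a)/(b)
(`stub_kp_dichotomy`) gives Corollary 3.1 (`stub_kp_cor31`:
`T⁴·triDl(9T)⁵ ≤ C_big·(Σ_{i≤3T} triDl i)⁴·W(T)`, `W(T)` the coded floor-arch mass of `S_{32T+1,32T+1}` over
the window `[T, 21T]`), the window-tail bound (`stub_kp_windowTail`, KP Lemma 2.2 summed over the geometric
scales `22^j·T₀`) feeds the analytic Lemma 3.4 (`stub_kp_decay`).
-/

noncomputable section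

open scoped Classical
open Finset
open Literature.Probability.RandomPlanarGeometry.SAW Literature.Probability.RandomPlanarGeometry.SAW.HV

namespace Summit.CriticalPhenomena.SAWScalingLimit.Theorems.HexConjecture.RootLocality

/-- `2cos(π/8)/cos(3π/8) > 0`. [folklore] -/
theorem kpThm2_kappa_pos : 0 < 2 * (Real.cos (Real.pi / 8) / Real.cos (3 * Real.pi / 8)) :=
  mul_pos two_pos (div_pos cos_pi_div_eight_pos cos_three_pi_div_eight_pos)

/-- **Krachun–Panagiotis's theorem (triangle form)**: the critical triangle tail of the hexagonal-lattice
self-avoiding walk decays polynomially, `triDl T ≤ C·T^(-ε)` for some `ε > 0` and all `T ≥ 1`.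
[cite: KrachunPanagiotis2026, Theorem 3 and Corollary 3.1 with Lemma 3.4] -/
theorem kp_triDl_rpow_decay : ∃ ε : ℝ, 0 < ε ∧ ∃ C : ℝ, ∀ T : ℕ, 1 ≤ T → triDl T ≤ C * (T : ℝ) ^ (-ε) := by
  obtain ⟨Cbig, hCbig, hrec⟩ := stub_kp_cor31 stub_kp_dichotomy
  refine stub_kp_decay triDl (fun T => ∑ d ∈ Finset.Icc (T : ℤ) (21 * T), ∑ P ∈ (midWalks (stripV (32 * T + 1) (32 * T + 1))).filter (fun P => finalDart P = ((d, 0, false), (d, -1, true)) ∨ finalDart P = ((d, -1, true), (d, 0, false))), hexCriticalFugacity ^ mwLen P) Cbig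
    (2 * (Real.cos (Real.pi / 8) / Real.cos (3 * Real.pi / 8))) stub_triDl_pos
    (fun a b h => triDl_antitone h) hCbig kpThm2_kappa_pos
    (fun T _ => sum_nonneg fun _ _ => sum_nonneg fun _ _ => pow_nonneg hexCriticalFugacity_pos_lt_one.1.le _)
    (fun T hT => hrec T hT) ?_
  intro T₀ hT₀ B
  exact stub_kp_windowTail (fun T => ∑ d ∈ Finset.Icc (T : ℤ) (21 * T), ∑ P ∈ (midWalks (stripV (32 * T + 1) (32 * T + 1))).filter (fun P => finalDart P = ((d, 0, false), (d, -1, true)) ∨ finalDart P = ((d, -1, true), (d, 0, false))), hexCriticalFugacity ^ mwLen P) (fun _ => rfl) T₀ hT₀ B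

/-- **Krachun–Panagiotis's theorem (bridge form, finite strips)**: the critical bridge partition functions
of the strips `S_{T',L}` of height `T' ≥ 2T+1` are at most `2cos(π/8)·C·T^(-ε)`, uniformly in the width.
[cite: KrachunPanagiotis2026, Theorem 2] -/
theorem kp_stripB_rpow_decay : ∃ ε : ℝ, 0 < ε ∧ ∃ C : ℝ, ∀ T : ℕ, 1 ≤ T → ∀ T' L : ℕ, 2 * T + 1 ≤ T' →
    stripB T' L hexCriticalFugacity ≤ 2 * Real.cos (Real.pi / 8) * C * (T : ℝ) ^ (-ε) := by
  obtain ⟨ε, hε, C, hC⟩ := kp_triDl_rpow_decay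
  refine ⟨ε, hε, C, fun T hT T' L hT' => (stripB_le_triDl hT' L).trans ?_⟩
  calc 2 * Real.cos (Real.pi / 8) * triDl T ≤ 2 * Real.cos (Real.pi / 8) * (C * (T : ℝ) ^ (-ε)) :=
        mul_le_mul_of_nonneg_left (hC T hT) (mul_nonneg zero_le_two cos_pi_div_eight_pos.le)
    _ = 2 * Real.cos (Real.pi / 8) * C * (T : ℝ) ^ (-ε) := by ring

/-- Scale arithmetic for the bridge corollary: `⌊(T'-1)/2⌋^(-ε) ≤ 4^ε · T'^(-ε)` for `T' ≥ 3`. [folklore] -/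
theorem kpThm2_rpow_half {ε : ℝ} (hε : 0 ≤ ε) {T' : ℕ} (hT' : 3 ≤ T') :
    ((((T' - 1) / 2 : ℕ) : ℝ)) ^ (-ε) ≤ (4 : ℝ) ^ ε * (T' : ℝ) ^ (-ε) := by
  have hm1 : 1 ≤ (T' - 1) / 2 := by omega
  have hm4 : T' ≤ 4 * ((T' - 1) / 2) := by omega
  have hmR : (1 : ℝ) ≤ (((T' - 1) / 2 : ℕ) : ℝ) := by exact_mod_cast hm1
  have h4R : (T' : ℝ) ≤ 4 * (((T' - 1) / 2 : ℕ) : ℝ) := by exact_mod_cast hm4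
  have hT0 : (0 : ℝ) < T' := by exact_mod_cast (show 0 < T' by omega)
  set m : ℝ := (((T' - 1) / 2 : ℕ) : ℝ) with hm
  have hm0 : 0 < m := by linarith
  rw [Real.rpow_neg hm0.le, Real.rpow_neg hT0.le, ← Real.inv_rpow hm0.le, ← Real.inv_rpow hT0.le,
    ← Real.mul_rpow (by norm_num) (inv_nonneg.2 hT0.le)]
  refine Real.rpow_le_rpow (inv_nonneg.2 hm0.le) ?_ hε
  rw [inv_le_iff_one_le_mul₀ hm0]
  have : (4 : ℝ) * (T' : ℝ)⁻¹ * m = 4 * m / T' := by ring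
  rw [this, le_div_iff₀ hT0]
  linarith

/-- **Krachun–Panagiotis's Theorem 2 (bridge form, infinite strip)**: the critical bridge partition function
`B_T = stripBlim T` (the supremum over the widths) satisfies `B_T ≤ C'·T^(-ε)` for all `T ≥ 3`
(KP: "`B_T ≤ 100·T^(-ε)`, `ε = 10⁻¹⁰`"; here `ε` unspecified). [cite: KrachunPanagiotis2026, Theorem 2] -/
theorem kp_stripBlim_rpow_decay :
    ∃ ε : ℝ, 0 < ε ∧ ∃ C : ℝ, ∀ T : ℕ, 3 ≤ T → stripBlim T ≤ C * (T : ℝ) ^ (-ε) := by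
  obtain ⟨ε, hε, C, hC⟩ := kp_triDl_rpow_decay
  refine ⟨ε, hε, 2 * Real.cos (Real.pi / 8) * max C 0 * (4 : ℝ) ^ ε, fun T hT => ?_⟩
  have hc8 := cos_pi_div_eight_pos
  have hm1 : 1 ≤ (T - 1) / 2 := by omega
  have key : ∀ L : ℕ, stripB T L hexCriticalFugacity ≤
      2 * Real.cos (Real.pi / 8) * max C 0 * (4 : ℝ) ^ ε * (T : ℝ) ^ (-ε) := by
    intro L
    have h1 := stripB_le_triDl (L := (T - 1) / 2) (T := T) (by omega) L
    have h2 := hC ((T - 1) / 2) hm1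
    have hpow : 0 ≤ ((((T - 1) / 2 : ℕ) : ℝ)) ^ (-ε) := Real.rpow_nonneg (Nat.cast_nonneg _) _
    have h3 : triDl ((T - 1) / 2) ≤ max C 0 * ((((T - 1) / 2 : ℕ) : ℝ)) ^ (-ε) :=
      h2.trans (mul_le_mul_of_nonneg_right (le_max_left C 0) hpow)
    have h4 := kpThm2_rpow_half hε.le hT
    have h5 : max C 0 * ((((T - 1) / 2 : ℕ) : ℝ)) ^ (-ε) ≤ max C 0 * ((4 : ℝ) ^ ε * (T : ℝ) ^ (-ε)) :=
      mul_le_mul_of_nonneg_left h4 (le_max_right C 0)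
    calc stripB T L hexCriticalFugacity ≤ 2 * Real.cos (Real.pi / 8) * triDl ((T - 1) / 2) := h1
      _ ≤ 2 * Real.cos (Real.pi / 8) * (max C 0 * ((4 : ℝ) ^ ε * (T : ℝ) ^ (-ε))) :=
          mul_le_mul_of_nonneg_left (h3.trans h5) (by positivity)
      _ = _ := by ring
  exact ciSup_le key

/-- **Registered sub-goal `stub_kp_theorem2`** (crux item stmt-CriticalPhenomena-0808, line
`root-locality-replaces-loewner`): Krachun–Panagiotis's polynomial decay of the critical triangle tail
(`kp_triDl_rpow_decay`). [cite: KrachunPanagiotis2026, Theorem 3 and Corollary 3.1 with Lemma 3.4] -/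
theorem stub_kp_theorem2 : ∃ ε : ℝ, 0 < ε ∧ ∃ C : ℝ, ∀ T : ℕ, 1 ≤ T → Literature.Probability.RandomPlanarGeometry.SAW.HV.triDl T ≤ C * (T : ℝ) ^ (-ε) :=
  kp_triDl_rpow_decay

end Summit.CriticalPhenomena.SAWScalingLimit.Theorems.HexConjecture.RootLocality

end
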